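import Mathlib.AlgebraicTopology.FundamentalGroupoid.FundamentalGroup
import Mathlib.AlgebraicTopology.FundamentalGroupoid.SimplyConnected
import Mathlib.Analysis.Convex.Contractible
import Mathlib.Topology.Subpath
import Mathlib.GroupTheory.QuotientGroup.Defs
import Mathlib.Topology.MetricSpace.Basic
import HarnessLib

/-!
# Seifert–van Kampen, kernel form (two open sets)

Trunk T-ALGTOP (fundamental group). This file proves the *kernel half* of the Seifert–van Kampen
theorem for a cover of a space `Y` by two open sets `U`, `T`, in the form in which it is used to
compute knot groups (e.g. Kervaire's lemma that the group of a 2-knot is normally generated by a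
meridian, `Literature/Topology/FourManifolds/GluckTwistMeridian.lean`):

**Theorem** (`Literature.AlgebraicTopology.FundamentalGroup.VanKampen.fromPath_mem_of_homotopic_refl`). Let `Y = U ∪ T` with `U`, `T` open,
`x₀ ∈ U ∩ T`, `U` and `U ∩ T` path connected, and let `N ⊴ π₁(U, x₀)` be a normal subgroup
containing the class of every loop of `U` at `x₀` that lies in `T`. Then every loop of `U` at `x₀`
which is null-homotopic in `Y` has its class in `N`.

Equivalently, `ker (π₁(U, x₀) → π₁(Y, x₀))` is contained in the normal closure of the image of
`π₁(U ∩ T, x₀)`; this is the part of van Kampen's theorem `π₁(Y) ≅ π₁(U) *_{π₁(U ∩ T)} π₁(T)`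
(Hatcher, *Algebraic Topology*, Thm. 1.20) that bounds the kernel, and the only part needed to show
that `π₁(U)` is normally generated by `π₁(U ∩ T)` when `Y` is simply connected. (Path
connectedness of `T` is not needed for this half.)

## Proof

The classical grid argument of the proof of Hatcher's Thm. 1.20, arranged so that no combinatorics
of factorisations is needed. Let `F : I × I → Y` be a null-homotopy of the loop `γ`. By the
Lebesgue number lemma there is an `n` such that every closed grid square
`[i/n, (i+1)/n] × [j/n, (j+1)/n]` is mapped into `U` or into `T` (`exists_grid`). For every point
`y ∈ U` choose a connecting path `conn y` from `x₀` to `y` inside `U ∩ T` if `y ∈ T` and inside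
`U` otherwise. To every path `E` of `Y` attach a *label* `lab E ∈ π₁(U, x₀) ⧸ N`: the class of the
loop `conn · E · conn⁻¹` if `E` runs in `U`, and `1` otherwise (`VKData.lab`). Then

* a path running in `T` has label `1` (if it also runs in `U`, its loop runs in `U ∩ T`, whose
  classes lie in `N` by hypothesis): `VKData.lab_eq_one_of_mem_T`;
* labels are multiplicative along concatenations inside `U` and invariant under homotopies inside
  `U`: `VKData.lab_trans`, `VKData.lab_congr`;
* hence for a grid square mapped into `U` the labels of its edges satisfy
  "bottom · right = left · top" (the two paths are homotopic inside the image of the square,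
  `homotopicWithin_of_square`), and for a square mapped into `T` all four labels are `1`;
* the left, right and top sides of `I × I` are mapped to `x₀`, so their edges have label `1`, and
  the product of the labels along the bottom side is the class of `γ` (`VKData.rowProd_bottom`,
  `VKData.cls_bottom`);
* a purely algebraic induction over the grid (`rowProd_eq_one_of_grid`) shows that the bottom
  product is `1`, i.e. `[γ] ∈ N`.

## Main statements

* `Literature.AlgebraicTopology.FundamentalGroup.VanKampen.fromPath_mem_of_homotopic_refl`: the theorem (unbundled form);
* `Literature.AlgebraicTopology.FundamentalGroup.VanKampen.VKData.fromPath_mem`: the same for the bundled datum `Literature.AlgebraicTopology.FundamentalGroup.VanKampen.VKData`;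
* tools: `Literature.AlgebraicTopology.FundamentalGroup.VanKampen.liftPath` (paths of `Y` inside `U` as paths of the subspace `U`),
  `Literature.AlgebraicTopology.FundamentalGroup.VanKampen.HomotopicWithin`, `Literature.AlgebraicTopology.FundamentalGroup.VanKampen.homotopicWithin_of_square` (square lemma),
  `Literature.AlgebraicTopology.FundamentalGroup.VanKampen.exists_grid` (Lebesgue subdivision of the square),
  `Literature.AlgebraicTopology.FundamentalGroup.VanKampen.rowProd_eq_one_of_grid` (grid lemma in a group).

## Sources

* A. Hatcher, *Algebraic Topology*, Cambridge Univ. Press (2002), §1.2, Thm. 1.20 (van Kampen's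
  theorem) and its proof [HatcherAT2002].
* Mathlib: `FundamentalGroup` (`= End` in the fundamental groupoid; `mul_def : p * q = q.trans p`),
  `Path.Homotopic.Quotient`, `Path.subpath`/`Path.Homotopy.subpathTransSubpath`
  (`Mathlib.Topology.Subpath`), `lebesgue_number_lemma_of_metric`, `Convex.contractibleSpace`.
  Mathlib has no form of the Seifert–van Kampen theorem for fundamental groups (searched
  `vanKampen`, `VanKampen`); the generation half for finite covers is
  `Literature/AlgebraicTopology/FundamentalGroup/FiniteCover.lean`.

## Design notes

* The receiving group is the quotient `π₁(U, x₀) ⧸ N` (`VKData.Q`); products of labels are written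
  in the reversed order forced by `FundamentalGroup.mul_def`.
* All path identities are stated with free endpoints and pointwise hypotheses
  (e.g. `homotopicWithin_of_square`, `VKData.lab_eq_of_lift`), which avoids casts between
  propositionally equal endpoints.
* `ContractibleSpace I` and `SimplyConnectedSpace (I × I)` are proved as theorems, not registered as
  instances.
* No declaration in this file uses `sorry`.
-/

noncomputable section

open Set Function unitInterval Topology

namespace Literature.AlgebraicTopology.FundamentalGroup

namespace VanKampen

variable {Y : Type*} [TopologicalSpace Y]

/-! ### Paths into a subspace -/

/-- A path of `Y` all of whose points lie in `U ⊆ Y`, as a path of the subspace `U`. [folklore] -/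
def liftPath (U : Set Y) {a b : Y} (p : Path a b) (hp : ∀ t, p t ∈ U) :
    Path (⟨a, p.source ▸ hp 0⟩ : U) ⟨b, p.target ▸ hp 1⟩ where
  toFun t := ⟨p t, hp t⟩
  continuous_toFun := p.continuous.subtype_mk _
  source' := Subtype.ext p.source
  target' := Subtype.ext p.target

/-- Points of the lifted path. [folklore] -/
@[simp]
theorem liftPath_apply_coe (U : Set Y) {a b : Y} (p : Path a b) (hp : ∀ t, p t ∈ U) (t : I) :
    (liftPath U p hp t : Y) = p t := rfl

/-- Lifting commutes with concatenation. [folklore] -/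
theorem liftPath_trans (U : Set Y) {a b c : Y} (p : Path a b) (q : Path b c)
    (hp : ∀ t, p t ∈ U) (hq : ∀ t, q t ∈ U) (h : ∀ t, p.trans q t ∈ U) :
    liftPath U (p.trans q) h = (liftPath U p hp).trans (liftPath U q hq) := by
  ext t
  change (p.trans q) t = (((liftPath U p hp).trans (liftPath U q hq)) t : Y)
  rw [Path.trans_apply, Path.trans_apply]
  split_ifs <;> rfl

/-- Lifting commutes with reversal. [folklore] -/
theorem liftPath_symm (U : Set Y) {a b : Y} (p : Path a b) (hp : ∀ t, p t ∈ U)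
    (h : ∀ t, p.symm t ∈ U) : liftPath U p.symm h = (liftPath U p hp).symm := by
  ext t
  rfl

/-- A concatenation of paths inside `S` stays inside `S`. [folklore] -/
theorem trans_mem {S : Set Y} {a b c : Y} {p : Path a b} {q : Path b c} (hp : ∀ t, p t ∈ S)
    (hq : ∀ t, q t ∈ S) (t : I) : p.trans q t ∈ S := by
  have : range (p.trans q) ⊆ S := by
    rw [Path.trans_range]
    exact union_subset (range_subset_iff.2 hp) (range_subset_iff.2 hq)
  exact this (mem_range_self t)

/-- The reverse of a path inside `S` stays inside `S`. [folklore] -/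
theorem symm_mem {S : Set Y} {a b : Y} {p : Path a b} (hp : ∀ t, p t ∈ S) (t : I) :
    p.symm t ∈ S := hp _

/-! ### Homotopies inside a subset -/

/-- Two paths of `Y` are *homotopic within* `S ⊆ Y` if they are joined by a homotopy (rel
endpoints) all of whose points lie in `S`. [folklore] -/
def HomotopicWithin (S : Set Y) {a b : Y} (p q : Path a b) : Prop :=
  ∃ F : p.Homotopy q, ∀ x, F x ∈ S

/-- The first path of a homotopy within `S` lies in `S`. [folklore] -/
theorem HomotopicWithin.left_mem {S : Set Y} {a b : Y} {p q : Path a b}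
    (h : HomotopicWithin S p q) (t : I) : p t ∈ S := by
  obtain ⟨F, hF⟩ := h
  simpa using hF (0, t)

/-- The second path of a homotopy within `S` lies in `S`. [folklore] -/
theorem HomotopicWithin.right_mem {S : Set Y} {a b : Y} {p q : Path a b}
    (h : HomotopicWithin S p q) (t : I) : q t ∈ S := by
  obtain ⟨F, hF⟩ := h
  simpa using hF (1, t)

/-- A homotopy inside `U` lifts to a homotopy of the lifted paths in the subspace `U`.
[folklore] -/
theorem HomotopicWithin.liftPath {U : Set Y} {a b : Y} {p q : Path a b}
    (h : HomotopicWithin U p q) (hp : ∀ t, p t ∈ U) (hq : ∀ t, q t ∈ U) :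
    (liftPath U p hp).Homotopic (liftPath U q hq) := by
  obtain ⟨F, hF⟩ := h
  exact ⟨{ toFun := fun x => ⟨F x, hF x⟩
           continuous_toFun := F.continuous.subtype_mk _
           map_zero_left := fun t => Subtype.ext (F.apply_zero t)
           map_one_left := fun t => Subtype.ext (F.apply_one t)
           prop' := fun s t ht => Subtype.ext (F.eq_fst s ht) }⟩

/-! ### The unit square is simply connected; the square lemma -/

/-- The unit interval is contractible (it is convex). Not registered as an instance. [folklore] -/
theorem contractibleSpace_unitInterval : ContractibleSpace I :=
  Convex.contractibleSpace (convex_Icc (0 : ℝ) 1) ⟨0, left_mem_Icc.2 zero_le_one⟩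

/-- The unit square is simply connected. Not registered as an instance. [folklore] -/
theorem simplyConnectedSpace_unitSquare : SimplyConnectedSpace (I × I) := by
  haveI := contractibleSpace_unitInterval
  infer_instance

/-- The bottom edge `u ↦ (0, u)` of the unit square. [folklore] -/
def edgeB : Path ((0, 0) : I × I) (0, 1) where
  toFun u := (0, u)
  continuous_toFun := by fun_prop
  source' := rfl
  target' := rfl

/-- The top edge `u ↦ (1, u)` of the unit square. [folklore] -/
def edgeT : Path ((1, 0) : I × I) (1, 1) where
  toFun u := (1, u)
  continuous_toFun := by fun_prop
  source' := rfl
  target' := rfl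

/-- The left edge `s ↦ (s, 0)` of the unit square. [folklore] -/
def edgeL : Path ((0, 0) : I × I) (1, 0) where
  toFun s := (s, 0)
  continuous_toFun := by fun_prop
  source' := rfl
  target' := rfl

/-- The right edge `s ↦ (s, 1)` of the unit square. [folklore] -/
def edgeR : Path ((0, 1) : I × I) (1, 1) where
  toFun s := (s, 1)
  continuous_toFun := by fun_prop
  source' := rfl
  target' := rfl

/-- **Square lemma.** For a continuous map `G` of the unit square into `Y` with values in `S`,
"bottom edge then right edge" is homotopic within `S` to "left edge then top edge". The four
paths are given by pointwise descriptions so that the lemma applies without casts. [folklore] -/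
theorem homotopicWithin_of_square {S : Set Y} (G : C(I × I, Y)) (hG : ∀ x, G x ∈ S)
    {a b c d : Y} (pb : Path a b) (pr : Path b d) (pl : Path a c) (pt : Path c d)
    (hb : ∀ u, pb u = G (0, u)) (hr : ∀ s, pr s = G (s, 1)) (hl : ∀ s, pl s = G (s, 0))
    (ht : ∀ u, pt u = G (1, u)) : HomotopicWithin S (pb.trans pr) (pl.trans pt) := by
  obtain rfl : a = G (0, 0) := pb.source.symm.trans (hb 0)
  obtain rfl : b = G (0, 1) := pb.target.symm.trans (hb 1)
  obtain rfl : c = G (1, 0) := pl.target.symm.trans (hl 1)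
  obtain rfl : d = G (1, 1) := pt.target.symm.trans (ht 1)
  obtain rfl : pb = edgeB.map G.continuous := by ext u; exact hb u
  obtain rfl : pr = edgeR.map G.continuous := by ext s; exact hr s
  obtain rfl : pl = edgeL.map G.continuous := by ext s; exact hl s
  obtain rfl : pt = edgeT.map G.continuous := by ext u; exact ht u
  rw [← Path.map_trans, ← Path.map_trans]
  haveI := simplyConnectedSpace_unitSquare
  obtain ⟨K⟩ := SimplyConnectedSpace.paths_homotopic (edgeB.trans edgeR) (edgeL.trans edgeT)
  exact ⟨K.map G, fun x => hG _⟩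

/-! ### The algebraic grid lemma -/

section Grid

variable {G : Type*} [Group G]

/-- Product of the first `k` horizontal labels of row `i`, in reversed (fundamental-group)
order: `rowProd H i k = H i (k-1) * ⋯ * H i 0`. [folklore] -/
def rowProd (H : ℕ → ℕ → G) (i : ℕ) : ℕ → G
  | 0 => 1
  | k + 1 => H i k * rowProd H i k

/-- The empty product. [folklore] -/
@[simp] theorem rowProd_zero (H : ℕ → ℕ → G) (i : ℕ) : rowProd H i 0 = 1 := rfl

/-- One more factor. [folklore] -/
theorem rowProd_succ (H : ℕ → ℕ → G) (i k : ℕ) :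
    rowProd H i (k + 1) = H i k * rowProd H i k := rfl

/-- **Grid lemma.** Edge labels `H i j` (edge `(i, j) → (i, j+1)`) and `V i j` (edge
`(i, j) → (i+1, j)`) in a group, satisfying for every unit square the relation
"bottom then right = left then top" (`V i (j+1) * H i j = H (i+1) j * V i j`, products in reversed
order), with trivial labels on the left column, right column and top row, have trivial product
along the bottom row. [folklore] -/
theorem rowProd_eq_one_of_grid (n : ℕ) (H V : ℕ → ℕ → G)
    (rel : ∀ i j, i < n → j < n → V i (j + 1) * H i j = H (i + 1) j * V i j)
    (hl : ∀ i, i < n → V i 0 = 1) (hr : ∀ i, i < n → V i n = 1)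
    (ht : ∀ j, j < n → H n j = 1) : rowProd H 0 n = 1 := by
  -- sweeping a row: `V i k * P i k = P (i+1) k * V i 0`
  have sweep : ∀ i, i < n → ∀ k, k ≤ n → V i k * rowProd H i k = rowProd H (i + 1) k * V i 0 := by
    intro i hi k
    induction k with
    | zero => intro; simp
    | succ k ih =>
      intro hk
      rw [rowProd_succ, rowProd_succ, ← mul_assoc, rel i k hi (by omega), mul_assoc,
        ih (by omega), mul_assoc]
  have rows : ∀ i, i < n → rowProd H i n = rowProd H (i + 1) n := by
    intro i hi
    have := sweep i hi n le_rfl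
    rwa [hr i hi, hl i hi, one_mul, mul_one] at this
  have top : ∀ k, k ≤ n → rowProd H n k = 1 := by
    intro k
    induction k with
    | zero => intro; rfl
    | succ k ih => intro hk; rw [rowProd_succ, ht k (by omega), ih (by omega), one_mul]
  have down : ∀ i, i ≤ n → rowProd H 0 n = rowProd H i n := by
    intro i
    induction i with
    | zero => intro; rfl
    | succ i ih => intro hi; rw [ih (by omega), rows i (by omega)]
  rw [down n le_rfl, top n le_rfl]

end Grid


/-! ### Grid coordinates and the Lebesgue subdivision -/

/-- The grid coordinate `k / n`, clamped to `[0, 1]` (junk value `1` for `k > n`). [folklore] -/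
def gc (n k : ℕ) : I :=
  ⟨min ((k : ℝ) / n) 1, le_min (by positivity) zero_le_one, min_le_right _ _⟩

/-- For `k ≤ n` the grid coordinate is `k / n`. [folklore] -/
theorem coe_gc_of_le {n k : ℕ} (hn : 0 < n) (hk : k ≤ n) : (gc n k : ℝ) = k / n := by
  apply min_eq_left
  rw [div_le_one (by exact_mod_cast hn)]
  exact_mod_cast hk

/-- The first grid coordinate is `0`. [folklore] -/
@[simp] theorem gc_zero (n : ℕ) : gc n 0 = 0 := Subtype.ext (by simp [gc])

/-- The last grid coordinate is `1`. [folklore] -/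
theorem gc_self {n : ℕ} (hn : 0 < n) : gc n n = 1 :=
  Subtype.ext (by simp [gc, hn.ne'])

/-- Grid coordinates increase. [folklore] -/
theorem gc_le_succ (n k : ℕ) : gc n k ≤ gc n (k + 1) := by
  change min ((k : ℝ) / n) 1 ≤ min (((k + 1 : ℕ) : ℝ) / n) 1
  exact min_le_min_right _ (div_le_div_of_nonneg_right (by exact_mod_cast k.le_succ) n.cast_nonneg)

/-- The closed grid square `[i/n, (i+1)/n] × [j/n, (j+1)/n]` of the unit square. [folklore] -/
def sq (n i j : ℕ) : Set (I × I) :=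
  {p | gc n i ≤ p.1 ∧ p.1 ≤ gc n (i + 1) ∧ gc n j ≤ p.2 ∧ p.2 ≤ gc n (j + 1)}

/-- The affine parametrisation of the grid square `(i, j)` by the unit square. [folklore] -/
def sqMap (n i j : ℕ) : C(I × I, I × I) where
  toFun p := (Set.Icc.convexComb (gc n i) (gc n (i + 1)) p.1,
    Set.Icc.convexComb (gc n j) (gc n (j + 1)) p.2)
  continuous_toFun := by fun_prop

/-- Formula for `sqMap`. [folklore] -/
theorem sqMap_apply (n i j : ℕ) (p : I × I) :
    sqMap n i j p = (Set.Icc.convexComb (gc n i) (gc n (i + 1)) p.1,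
      Set.Icc.convexComb (gc n j) (gc n (j + 1)) p.2) := rfl

/-- `sqMap` takes values in the grid square. [folklore] -/
theorem sqMap_mem (n i j : ℕ) (p : I × I) : sqMap n i j p ∈ sq n i j :=
  ⟨Set.Icc.le_convexComb (gc_le_succ n i) _, Set.Icc.convexComb_le (gc_le_succ n i) _,
    Set.Icc.le_convexComb (gc_le_succ n j) _, Set.Icc.convexComb_le (gc_le_succ n j) _⟩

/-- **Lebesgue subdivision.** A continuous map of the unit square into `U ∪ T` (`U`, `T` open)
maps every square of a fine enough grid into `U` or into `T`. [folklore] -/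
theorem exists_grid (F : C(I × I, Y)) {U T : Set Y} (hU : IsOpen U) (hT : IsOpen T)
    (hcov : ∀ x, F x ∈ U ∨ F x ∈ T) :
    ∃ n : ℕ, 0 < n ∧ ∀ i j, i < n → j < n → MapsTo F (sq n i j) U ∨ MapsTo F (sq n i j) T := by
  let c : Bool → Set (I × I) := fun b => bif b then F ⁻¹' U else F ⁻¹' T
  have hc₁ : ∀ b, IsOpen (c b) := by
    rintro (_ | _)
    exacts [hT.preimage F.continuous, hU.preimage F.continuous]
  have hc₂ : (univ : Set (I × I)) ⊆ ⋃ b, c b := by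
    intro x _
    rcases hcov x with h | h
    · exact mem_iUnion.2 ⟨true, h⟩
    · exact mem_iUnion.2 ⟨false, h⟩
  obtain ⟨δ, hδ, hball⟩ := lebesgue_number_lemma_of_metric isCompact_univ hc₁ hc₂
  obtain ⟨m, hm⟩ := exists_nat_one_div_lt hδ
  have hn : 0 < m + 1 := m.succ_pos
  refine ⟨m + 1, hn, fun i j hi hj => ?_⟩
  obtain ⟨b, hb⟩ := hball (gc (m + 1) i, gc (m + 1) j) (mem_univ _)
  have hstep : ∀ k, k < m + 1 → (gc (m + 1) (k + 1) : ℝ) - gc (m + 1) k = 1 / (m + 1 : ℝ) := by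
    intro k hk
    rw [coe_gc_of_le hn (by omega), coe_gc_of_le hn (by omega)]
    push_cast
    ring
  have hsub : sq (m + 1) i j ⊆ Metric.ball (gc (m + 1) i, gc (m + 1) j) δ := by
    rintro ⟨p₁, p₂⟩ ⟨h1, h2, h3, h4⟩
    rw [Metric.mem_ball, Prod.dist_eq, max_lt_iff]
    refine ⟨?_, ?_⟩
    · rw [Subtype.dist_eq, Real.dist_eq,
        abs_of_nonneg (sub_nonneg.2 (Subtype.coe_le_coe.2 h1))]
      calc (p₁ : ℝ) - gc (m + 1) i ≤ gc (m + 1) (i + 1) - gc (m + 1) i :=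
            sub_le_sub_right (Subtype.coe_le_coe.2 h2) _
        _ = 1 / (m + 1 : ℝ) := hstep i hi
        _ < δ := hm
    · rw [Subtype.dist_eq, Real.dist_eq,
        abs_of_nonneg (sub_nonneg.2 (Subtype.coe_le_coe.2 h3))]
      calc (p₂ : ℝ) - gc (m + 1) j ≤ gc (m + 1) (j + 1) - gc (m + 1) j :=
            sub_le_sub_right (Subtype.coe_le_coe.2 h4) _
        _ = 1 / (m + 1 : ℝ) := hstep j hj
        _ < δ := hm
  cases b with
  | true => exact Or.inl fun x hx => hb (hsub hx)
  | false => exact Or.inr fun x hx => hb (hsub hx)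

/-! ### Rows, columns and edges of a map of the square -/

/-- The row `t ↦ F (s, t)` of a map of the unit square. [folklore] -/
def rowPath (F : C(I × I, Y)) (s : I) : Path (F (s, 0)) (F (s, 1)) where
  toFun t := F (s, t)
  continuous_toFun := by fun_prop
  source' := rfl
  target' := rfl

/-- The column `s ↦ F (s, t)` of a map of the unit square. [folklore] -/
def colPath (F : C(I × I, Y)) (t : I) : Path (F (0, t)) (F (1, t)) where
  toFun s := F (s, t)
  continuous_toFun := by fun_prop
  source' := rfl
  target' := rfl

/-- The horizontal grid edge from the vertex `(i, j)` to `(i, j+1)`, mapped by `F`. [folklore] -/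
def hEdge (F : C(I × I, Y)) (n i j : ℕ) :
    Path (F (gc n i, gc n j)) (F (gc n i, gc n (j + 1))) :=
  (rowPath F (gc n i)).subpath (gc n j) (gc n (j + 1))

/-- The vertical grid edge from the vertex `(i, j)` to `(i+1, j)`, mapped by `F`. [folklore] -/
def vEdge (F : C(I × I, Y)) (n i j : ℕ) :
    Path (F (gc n i, gc n j)) (F (gc n (i + 1), gc n j)) :=
  (colPath F (gc n j)).subpath (gc n i) (gc n (i + 1))

/-- Points of a horizontal edge. [folklore] -/
theorem hEdge_apply (F : C(I × I, Y)) (n i j : ℕ) (u : I) :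
    hEdge F n i j u = F (gc n i, Set.Icc.convexComb (gc n j) (gc n (j + 1)) u) := rfl

/-- Points of a vertical edge. [folklore] -/
theorem vEdge_apply (F : C(I × I, Y)) (n i j : ℕ) (u : I) :
    vEdge F n i j u = F (Set.Icc.convexComb (gc n i) (gc n (i + 1)) u, gc n j) := rfl

/-- The bottom edge of the square `(i, j)` lies in it. [folklore] -/
theorem hEdge_mem (n i j : ℕ) (u : I) :
    (gc n i, Set.Icc.convexComb (gc n j) (gc n (j + 1)) u) ∈ sq n i j :=
  ⟨le_rfl, gc_le_succ n i, Set.Icc.le_convexComb (gc_le_succ n j) _,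
    Set.Icc.convexComb_le (gc_le_succ n j) _⟩

/-- The top edge of the square `(i, j)` lies in it. [folklore] -/
theorem hEdge_succ_mem (n i j : ℕ) (u : I) :
    (gc n (i + 1), Set.Icc.convexComb (gc n j) (gc n (j + 1)) u) ∈ sq n i j :=
  ⟨gc_le_succ n i, le_rfl, Set.Icc.le_convexComb (gc_le_succ n j) _,
    Set.Icc.convexComb_le (gc_le_succ n j) _⟩

/-- The left edge of the square `(i, j)` lies in it. [folklore] -/
theorem vEdge_mem (n i j : ℕ) (u : I) :
    (Set.Icc.convexComb (gc n i) (gc n (i + 1)) u, gc n j) ∈ sq n i j :=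
  ⟨Set.Icc.le_convexComb (gc_le_succ n i) _, Set.Icc.convexComb_le (gc_le_succ n i) _,
    le_rfl, gc_le_succ n j⟩

/-- The right edge of the square `(i, j)` lies in it. [folklore] -/
theorem vEdge_succ_mem (n i j : ℕ) (u : I) :
    (Set.Icc.convexComb (gc n i) (gc n (i + 1)) u, gc n (j + 1)) ∈ sq n i j :=
  ⟨Set.Icc.le_convexComb (gc_le_succ n i) _, Set.Icc.convexComb_le (gc_le_succ n i) _,
    gc_le_succ n j, le_rfl⟩

/-! ### The datum and the label calculus -/

/-- Cancellation in the fundamental groupoid: `γ⁻¹ · (γ · δ) = δ`. [folklore] -/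
@[simp]
theorem symm_trans_cancel {a b c : Y} (γ : Path.Homotopic.Quotient a b)
    (δ : Path.Homotopic.Quotient b c) : γ.symm.trans (γ.trans δ) = δ := by
  rw [← Path.Homotopic.Quotient.trans_assoc, Path.Homotopic.Quotient.symm_trans,
    Path.Homotopic.Quotient.refl_trans]

/-- Cancellation in the fundamental groupoid: `γ · (γ⁻¹ · δ) = δ`. [folklore] -/
@[simp]
theorem trans_symm_cancel {a b c : Y} (γ : Path.Homotopic.Quotient a b)
    (δ : Path.Homotopic.Quotient a c) : γ.trans (γ.symm.trans δ) = δ := by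
  rw [← Path.Homotopic.Quotient.trans_assoc, Path.Homotopic.Quotient.trans_symm,
    Path.Homotopic.Quotient.refl_trans]

variable (Y) in
/-- **The datum of the kernel argument**: an open pair `U, T ⊆ Y`, a base point `x₀ ∈ U ∩ T`
with `U` and `U ∩ T` path connected, and a normal subgroup `N ⊴ π₁(U, x₀)` containing the classes
of all loops of `U` at `x₀` that stay inside `T` (the hypotheses of
`fromPath_mem_of_homotopic_refl`, bundled so that the label calculus can refer to them). [folklore] -/
structure VKData where
  /-- The piece whose fundamental group is studied. -/
  U : Set Y
  /-- The other piece. -/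
  T : Set Y
  /-- The base point. -/
  x₀ : Y
  /-- The base point lies in `U`. -/
  hxU : x₀ ∈ U
  /-- The base point lies in `T`. -/
  hxT : x₀ ∈ T
  /-- `U` is path connected. -/
  hUpc : IsPathConnected U
  /-- `U ∩ T` is path connected. -/
  hmeet : IsPathConnected (U ∩ T)
  /-- The normal subgroup of `π₁(U, x₀)`. -/
  N : Subgroup (FundamentalGroup U ⟨x₀, hxU⟩)
  /-- `N` is normal. -/
  normal : N.Normal
  /-- `N` contains the classes of the loops of `U` at `x₀` lying in `T`. -/
  hN : ∀ δ : Path (⟨x₀, hxU⟩ : U) ⟨x₀, hxU⟩, (∀ t, (δ t : Y) ∈ T) →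
    FundamentalGroup.fromPath (Path.Homotopic.Quotient.mk δ) ∈ N

namespace VKData

variable (D : VKData Y)

/-- `N` is normal (field `normal` as an instance). [folklore] -/
instance : D.N.Normal := D.normal

/-- The base point of the subspace `U`. [folklore] -/
abbrev z₀ : D.U := ⟨D.x₀, D.hxU⟩

/-- The receiving group `π₁(U, x₀) ⧸ N`. [folklore] -/
abbrev Q : Type _ := FundamentalGroup D.U D.z₀ ⧸ D.N

/-- The class of a loop of `U` at the base point in `π₁(U, x₀) ⧸ N`. [folklore] -/
abbrev cls (δ : Path D.z₀ D.z₀) : D.Q :=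
  QuotientGroup.mk (FundamentalGroup.fromPath (Path.Homotopic.Quotient.mk δ))

open Classical in
/-- Connecting path from the base point to `y ∈ U`: inside `U ∩ T` when `y ∈ T`, inside `U`
otherwise (Hatcher's paths `g_v`, proof of Thm. 1.20). [cite: HatcherAT2002, proof of Thm. 1.20] -/
def conn (y : Y) (hy : y ∈ D.U) : Path D.x₀ y :=
  if h : y ∈ D.T then (D.hmeet.joinedIn D.x₀ ⟨D.hxU, D.hxT⟩ y ⟨hy, h⟩).somePath
  else (D.hUpc.joinedIn D.x₀ D.hxU y hy).somePath

/-- Connecting paths run in `U`. [folklore] -/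
theorem conn_mem (y : Y) (hy : y ∈ D.U) (t : I) : D.conn y hy t ∈ D.U := by
  unfold conn
  split_ifs with h
  · exact ((D.hmeet.joinedIn D.x₀ ⟨D.hxU, D.hxT⟩ y ⟨hy, h⟩).somePath_mem t).1
  · exact (D.hUpc.joinedIn D.x₀ D.hxU y hy).somePath_mem t

/-- Connecting paths to points of `T` run in `T`. [folklore] -/
theorem conn_mem_T (y : Y) (hy : y ∈ D.U) (h : y ∈ D.T) (t : I) : D.conn y hy t ∈ D.T := by
  unfold conn
  rw [dif_pos h]
  exact ((D.hmeet.joinedIn D.x₀ ⟨D.hxU, D.hxT⟩ y ⟨hy, h⟩).somePath_mem t).2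

/-- The connecting path as a path of the subspace `U`. [folklore] -/
def connZ (z : D.U) : Path D.z₀ z :=
  liftPath D.U (D.conn z z.2) (D.conn_mem z z.2)

/-- Points of `connZ`. [folklore] -/
@[simp]
theorem connZ_apply_coe (z : D.U) (t : I) : (D.connZ z t : Y) = D.conn z z.2 t := rfl

/-- The loop `conn(y) · E · conn(y')⁻¹` of `U` at the base point attached to a path `E` of `Y`
running in `U`. [cite: HatcherAT2002, proof of Thm. 1.20] -/
def loopZ {y y' : Y} (E : Path y y') (hE : ∀ t, E t ∈ D.U) : Path D.z₀ D.z₀ :=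
  (D.connZ ⟨y, E.source ▸ hE 0⟩).trans
    ((liftPath D.U E hE).trans (D.connZ ⟨y', E.target ▸ hE 1⟩).symm)

open Classical in
/-- **The label of a path** `E` of `Y`: the class of `conn · E · conn⁻¹` in `π₁(U, x₀) ⧸ N` if `E`
runs in `U`, and `1` otherwise. [folklore] -/
def lab {y y' : Y} (E : Path y y') : D.Q :=
  if hE : ∀ t, E t ∈ D.U then D.cls (D.loopZ E hE) else 1

/-- The label of a path running in `U`. [folklore] -/
theorem lab_of_mem {y y' : Y} (E : Path y y') (hE : ∀ t, E t ∈ D.U) :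
    D.lab E = D.cls (D.loopZ E hE) := dif_pos hE

/-- The label of a path leaving `U` is `1`. [folklore] -/
theorem lab_of_not_mem {y y' : Y} (E : Path y y') (hE : ¬ ∀ t, E t ∈ D.U) : D.lab E = 1 :=
  dif_neg hE

/-- A path running in `U ∩ T` has trivial label (its loop stays in `T`). [folklore] -/
theorem lab_eq_one_of_mem_inter {y y' : Y} (E : Path y y') (hE : ∀ t, E t ∈ D.U)
    (hT : ∀ t, E t ∈ D.T) : D.lab E = 1 := by
  rw [D.lab_of_mem E hE, cls, QuotientGroup.eq_one_iff]
  apply D.hN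
  have hy : y ∈ D.T := E.source ▸ hT 0
  have hy' : y' ∈ D.T := E.target ▸ hT 1
  have hsub : range (D.loopZ E hE) ⊆ {z | (z : Y) ∈ D.T} := by
    unfold loopZ
    rw [Path.trans_range, Path.trans_range, Path.symm_range]
    refine union_subset ?_ (union_subset ?_ ?_) <;> rintro _ ⟨s, rfl⟩
    · exact D.conn_mem_T y _ hy s
    · exact hT s
    · exact D.conn_mem_T y' _ hy' s
  exact fun t => hsub ⟨t, rfl⟩

/-- A path running in `T` has trivial label. [folklore] -/
theorem lab_eq_one_of_mem_T {y y' : Y} (E : Path y y') (hT : ∀ t, E t ∈ D.T) :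
    D.lab E = 1 := by
  by_cases hE : ∀ t, E t ∈ D.U
  · exact D.lab_eq_one_of_mem_inter E hE hT
  · exact D.lab_of_not_mem E hE

/-- The label of a path with a given lift `EZ` to the subspace `U` is the class of
`conn · EZ · conn⁻¹`. [folklore] -/
theorem lab_eq_of_lift {y y' : Y} (E : Path y y') {z z' : D.U} (EZ : Path z z')
    (h : ∀ t, (EZ t : Y) = E t) :
    D.lab E = D.cls ((D.connZ z).trans (EZ.trans (D.connZ z').symm)) := by
  obtain ⟨z, hz⟩ := z
  obtain ⟨z', hz'⟩ := z'
  obtain rfl : y = z := by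
    rw [← E.source, ← h 0, EZ.source]
  obtain rfl : y' = z' := by
    rw [← E.target, ← h 1, EZ.target]
  have hE : ∀ t, E t ∈ D.U := fun t => h t ▸ (EZ t).2
  have hlift : liftPath D.U E hE = EZ := by
    ext t
    exact (h t).symm
  rw [D.lab_of_mem E hE]
  unfold loopZ
  rw [hlift]

/-- Labels are invariant under homotopies inside `U`. [folklore] -/
theorem lab_congr {y y' : Y} {E E' : Path y y'} (h : HomotopicWithin D.U E E') :
    D.lab E = D.lab E' := by
  have hE := h.left_mem
  have hE' := h.right_mem
  rw [D.lab_of_mem E hE, D.lab_of_mem E' hE']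
  have : (D.loopZ E hE).Homotopic (D.loopZ E' hE') :=
    Path.Homotopic.hcomp (Path.Homotopic.refl _)
      (Path.Homotopic.hcomp (h.liftPath hE hE') (Path.Homotopic.refl _))
  exact congrArg (fun q : Path.Homotopic.Quotient D.z₀ D.z₀ =>
    (QuotientGroup.mk (FundamentalGroup.fromPath q) : D.Q)) (Path.Homotopic.Quotient.eq.2 this)

/-- Labels are multiplicative along concatenation of paths running in `U` (reversed order, as in
the fundamental group). [folklore] -/
theorem lab_trans {y y' y'' : Y} (E₁ : Path y y') (E₂ : Path y' y'') (h₁ : ∀ t, E₁ t ∈ D.U)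
    (h₂ : ∀ t, E₂ t ∈ D.U) : D.lab (E₁.trans E₂) = D.lab E₂ * D.lab E₁ := by
  have h₁₂ : ∀ t, E₁.trans E₂ t ∈ D.U := trans_mem h₁ h₂
  rw [D.lab_of_mem _ h₁₂, D.lab_of_mem _ h₁, D.lab_of_mem _ h₂, cls, cls, cls,
    ← QuotientGroup.mk_mul]
  congr 1
  unfold loopZ
  rw [liftPath_trans D.U E₁ E₂ h₁ h₂ h₁₂, FundamentalGroup.mul_def]
  simp only [FundamentalGroup.fromPath, FundamentalGroup.fromArrow,
    Path.Homotopic.Quotient.mk_trans, Path.Homotopic.Quotient.mk_symm,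
    Path.Homotopic.Quotient.trans_assoc, symm_trans_cancel]

/-- Conjugating by the connecting loop at the base point (a loop inside `U ∩ T`) does not change
the class in `π₁(U, x₀) ⧸ N`. [folklore] -/
theorem cls_conn_conj {w w' : D.U} (δ : Path w w') (hw : D.z₀ = w) (hw' : D.z₀ = w') :
    D.cls ((D.connZ w).trans (δ.trans (D.connZ w').symm)) = D.cls (δ.cast hw hw') := by
  subst hw hw'
  have hc : D.cls (D.connZ D.z₀) = 1 := by
    rw [cls, QuotientGroup.eq_one_iff]
    exact D.hN _ fun t => D.conn_mem_T D.x₀ D.hxU D.hxT t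
  have hcast : δ.cast rfl rfl = δ := by
    ext t
    rfl
  have e : (FundamentalGroup.fromPath (Path.Homotopic.Quotient.mk
      ((D.connZ D.z₀).trans (δ.trans (D.connZ D.z₀).symm))) : FundamentalGroup D.U D.z₀) =
      (FundamentalGroup.fromPath (Path.Homotopic.Quotient.mk (D.connZ D.z₀)))⁻¹ *
        (FundamentalGroup.fromPath (Path.Homotopic.Quotient.mk δ) *
          FundamentalGroup.fromPath (Path.Homotopic.Quotient.mk (D.connZ D.z₀))) := by
    simp only [FundamentalGroup.fromPath, FundamentalGroup.fromArrow, FundamentalGroup.mul_def,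
      FundamentalGroup.inv_def, Path.Homotopic.Quotient.mk_trans, Path.Homotopic.Quotient.mk_symm,
      Path.Homotopic.Quotient.trans_assoc]
  rw [hcast, cls, e, QuotientGroup.mk_mul, QuotientGroup.mk_mul, QuotientGroup.mk_inv]
  rw [cls] at hc
  rw [hc, inv_one, one_mul, mul_one]

/-! ### The bottom row -/

/-- The product of the labels of the first `k` bottom edges is the class of
`conn · γ|[0, k/n] · conn⁻¹`. [folklore] -/
theorem rowProd_bottom (γ : Path D.z₀ D.z₀) (F : C(I × I, Y)) (hF0 : ∀ t, F (0, t) = (γ t : Y))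
    (n : ℕ) (k : ℕ) :
    rowProd (fun i j => D.lab (hEdge F n i j)) 0 k =
      D.cls ((D.connZ (γ (gc n 0))).trans
        ((γ.subpath (gc n 0) (gc n k)).trans (D.connZ (γ (gc n k))).symm)) := by
  induction k with
  | zero =>
    rw [rowProd_zero, Path.subpath_self, cls]
    simp only [FundamentalGroup.fromPath, FundamentalGroup.fromArrow,
      Path.Homotopic.Quotient.mk_trans, Path.Homotopic.Quotient.mk_symm,
      Path.Homotopic.Quotient.mk_refl, Path.Homotopic.Quotient.refl_trans,
      Path.Homotopic.Quotient.trans_symm]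
    exact (QuotientGroup.mk_one _).symm
  | succ k ih =>
    rw [rowProd_succ, ih]
    have hk : D.lab (hEdge F n 0 k) = D.cls ((D.connZ (γ (gc n k))).trans
        ((γ.subpath (gc n k) (gc n (k + 1))).trans (D.connZ (γ (gc n (k + 1)))).symm)) := by
      apply D.lab_eq_of_lift
      intro t
      rw [hEdge_apply, gc_zero, hF0]
      rfl
    rw [hk, cls, cls, cls, ← QuotientGroup.mk_mul, FundamentalGroup.mul_def]
    congr 1
    have hS : ∀ ρ : Path.Homotopic.Quotient (γ (gc n (k + 1))) D.z₀,
        (Path.Homotopic.Quotient.mk (γ.subpath (gc n 0) (gc n k))).trans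
          ((Path.Homotopic.Quotient.mk (γ.subpath (gc n k) (gc n (k + 1)))).trans ρ) =
        (Path.Homotopic.Quotient.mk (γ.subpath (gc n 0) (gc n (k + 1)))).trans ρ := by
      intro ρ
      rw [← Path.Homotopic.Quotient.trans_assoc, ← Path.Homotopic.Quotient.mk_trans,
        Path.Homotopic.Quotient.eq.2 ⟨Path.Homotopy.subpathTransSubpath γ _ _ _⟩]
    simp only [FundamentalGroup.fromPath, FundamentalGroup.fromArrow,
      Path.Homotopic.Quotient.mk_trans, Path.Homotopic.Quotient.mk_symm,
      Path.Homotopic.Quotient.trans_assoc, symm_trans_cancel, hS]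

/-- The full bottom row is the class of `γ`. [folklore] -/
theorem cls_bottom (γ : Path D.z₀ D.z₀) (t₀ t₁ : I) (h0 : t₀ = 0) (h1 : t₁ = 1) :
    D.cls ((D.connZ (γ t₀)).trans ((γ.subpath t₀ t₁).trans (D.connZ (γ t₁)).symm)) =
      D.cls γ := by
  subst h0 h1
  rw [D.cls_conn_conj _ γ.source.symm γ.target.symm]
  congr 1
  ext t
  rw [Path.cast_coe, Path.subpath_zero_one, Path.cast_coe]

/-! ### The main theorem -/

/-- **Seifert–van Kampen, kernel form** (Hatcher, *Algebraic Topology*, Thm. 1.20, the case of two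
open sets, injectivity half): with the datum `D` (`U`, `T` open covering `Y`, `x₀ ∈ U ∩ T`, `U` and
`U ∩ T` path connected, `N ⊴ π₁(U, x₀)` containing the classes of the loops of `U` inside `T`),
every loop of `U` at `x₀` that is null-homotopic in `Y` has its class in `N`. Real proof (Lebesgue
grid on a null-homotopy, labels of grid edges in `π₁(U, x₀) ⧸ N`, square relations).
[cite: HatcherAT2002, Thm. 1.20] -/
theorem fromPath_mem (hUo : IsOpen D.U) (hTo : IsOpen D.T) (hUT : D.U ∪ D.T = univ)
    (γ : Path D.z₀ D.z₀) (hγ : (γ.map continuous_subtype_val).Homotopic (Path.refl D.x₀)) :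
    FundamentalGroup.fromPath (Path.Homotopic.Quotient.mk γ) ∈ D.N := by
  obtain ⟨F'⟩ := hγ
  let F : C(I × I, Y) := F'.toContinuousMap
  have hF0 : ∀ t, F (0, t) = (γ t : Y) := fun t => F'.apply_zero t
  have hF1 : ∀ t, F (1, t) = D.x₀ := fun t => F'.apply_one t
  have hFs0 : ∀ s, F (s, 0) = D.x₀ := fun s => F'.source s
  have hFs1 : ∀ s, F (s, 1) = D.x₀ := fun s => F'.target s
  obtain ⟨n, hn, hsq⟩ := exists_grid F hUo hTo fun x => by
    have : F x ∈ D.U ∪ D.T := by rw [hUT]; exact mem_univ _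
    exact this
  -- edge labels
  let H : ℕ → ℕ → D.Q := fun i j => D.lab (hEdge F n i j)
  let V : ℕ → ℕ → D.Q := fun i j => D.lab (vEdge F n i j)
  -- square relations
  have rel : ∀ i j, i < n → j < n → V i (j + 1) * H i j = H (i + 1) j * V i j := by
    intro i j hi hj
    rcases hsq i j hi hj with hU | hT
    · have hbU : ∀ u, hEdge F n i j u ∈ D.U := fun u => hU (hEdge_mem n i j u)
      have htU : ∀ u, hEdge F n (i + 1) j u ∈ D.U := fun u => hU (hEdge_succ_mem n i j u)
      have hlU : ∀ u, vEdge F n i j u ∈ D.U := fun u => hU (vEdge_mem n i j u)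
      have hrU : ∀ u, vEdge F n i (j + 1) u ∈ D.U := fun u => hU (vEdge_succ_mem n i j u)
      have hw : HomotopicWithin D.U ((hEdge F n i j).trans (vEdge F n i (j + 1)))
          ((vEdge F n i j).trans (hEdge F n (i + 1) j)) := by
        refine homotopicWithin_of_square (F.comp (sqMap n i j)) (fun p => hU (sqMap_mem n i j p))
          _ _ _ _ (fun u => ?_) (fun u => ?_) (fun u => ?_) (fun u => ?_)
        · rw [hEdge_apply, ContinuousMap.comp_apply, sqMap_apply, Set.Icc.convexComb_zero]
        · rw [vEdge_apply, ContinuousMap.comp_apply, sqMap_apply, Set.Icc.convexComb_one]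
        · rw [vEdge_apply, ContinuousMap.comp_apply, sqMap_apply, Set.Icc.convexComb_zero]
        · rw [hEdge_apply, ContinuousMap.comp_apply, sqMap_apply, Set.Icc.convexComb_one]
      have e := D.lab_congr hw
      rw [D.lab_trans _ _ hbU hrU, D.lab_trans _ _ hlU htU] at e
      exact e
    · have hb : H i j = 1 := D.lab_eq_one_of_mem_T _ fun u => hT (hEdge_mem n i j u)
      have ht : H (i + 1) j = 1 := D.lab_eq_one_of_mem_T _ fun u => hT (hEdge_succ_mem n i j u)
      have hl : V i j = 1 := D.lab_eq_one_of_mem_T _ fun u => hT (vEdge_mem n i j u)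
      have hr : V i (j + 1) = 1 := D.lab_eq_one_of_mem_T _ fun u => hT (vEdge_succ_mem n i j u)
      rw [hb, ht, hl, hr]
  -- boundary labels
  have hleft : ∀ i, i < n → V i 0 = 1 := fun i _ =>
    D.lab_eq_one_of_mem_T _ fun u => by rw [vEdge_apply, gc_zero, hFs0]; exact D.hxT
  have hright : ∀ i, i < n → V i n = 1 := fun i _ =>
    D.lab_eq_one_of_mem_T _ fun u => by rw [vEdge_apply, gc_self hn, hFs1]; exact D.hxT
  have htop : ∀ j, j < n → H n j = 1 := fun j _ =>
    D.lab_eq_one_of_mem_T _ fun u => by rw [hEdge_apply, gc_self hn, hF1]; exact D.hxT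
  have hgrid := rowProd_eq_one_of_grid n H V rel hleft hright htop
  have hbot := D.rowProd_bottom γ F hF0 n n
  have hfin := D.cls_bottom γ (gc n 0) (gc n n) (gc_zero n) (gc_self hn)
  rw [← QuotientGroup.eq_one_iff, ← cls, ← hfin, ← hbot]
  exact hgrid

end VKData

/-- **Seifert–van Kampen, kernel form, unbundled statement** (Hatcher, *Algebraic Topology*,
Thm. 1.20, two open sets, injectivity half). Let `Y = U ∪ T` with `U`, `T` open, `x₀ ∈ U ∩ T`,
`U` and `U ∩ T` path connected, and let `N` be a normal subgroup of `π₁(U, x₀)` containing the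
class of every loop of `U` at `x₀` lying in `T`. Then the class of every loop of `U` at `x₀` which
is null-homotopic in `Y` lies in `N`. (Equivalently: the kernel of `π₁(U) → π₁(Y)` is contained in
the normal closure of the image of `π₁(U ∩ T)`, the containment `π₁(Y) ≅ π₁(U) *_{π₁(U ∩ T)} π₁(T)`
makes obvious.) [cite: HatcherAT2002, Thm. 1.20] -/
theorem fromPath_mem_of_homotopic_refl {U T : Set Y} (hU : IsOpen U) (hT : IsOpen T)
    (hUT : U ∪ T = univ) (hUpc : IsPathConnected U) (hmeet : IsPathConnected (U ∩ T))
    {x₀ : Y} (hxU : x₀ ∈ U) (hxT : x₀ ∈ T) (N : Subgroup (FundamentalGroup U ⟨x₀, hxU⟩))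
    [N.Normal]
    (hN : ∀ δ : Path (⟨x₀, hxU⟩ : U) ⟨x₀, hxU⟩, (∀ t, (δ t : Y) ∈ T) →
      FundamentalGroup.fromPath (Path.Homotopic.Quotient.mk δ) ∈ N)
    (γ : Path (⟨x₀, hxU⟩ : U) ⟨x₀, hxU⟩)
    (hγ : (γ.map continuous_subtype_val).Homotopic (Path.refl x₀)) :
    FundamentalGroup.fromPath (Path.Homotopic.Quotient.mk γ) ∈ N :=
  VKData.fromPath_mem ⟨U, T, x₀, hxU, hxT, hUpc, hmeet, N, inferInstance, hN⟩ hU hT hUT γ hγ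

end VanKampen

end Literature.AlgebraicTopology.FundamentalGroup
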